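import Literature.MathematicalPhysics.QuantumFieldTheory.Balaban1983to89.Beta.Assembly
import Literature.MathematicalPhysics.QuantumFieldTheory.Balaban1983to89.Beta.RemainderChain

/-!
# Bałaban's β-functions: the top-node carriers fed by the CONSTANT-FORM remainder bound

T. Bałaban, *Renormalization group approach to lattice gauge field theories. I*, Comm. Math. Phys. **109** (1987)
249–301 [I]; *II. Cluster expansions*, Comm. Math. Phys. **116** (1988) 1–22 [II].

This is a BRIDGE between two landed modules of the β sub-cell, both imported and untouched:

* `Beta.Assembly` (row an5): the hypothesis carriers `LimitForm` / `EventualForm` / `BoundedForm` of the residual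
  flow-side inputs and every located consumer of the flow by name (`EventualForm.endpointExistence`,
  `EventualForm.p355_and_sum246`, `EventualForm.thm2_fineLattices`, `EventualForm.thm2Printed_of_list`, …).  Its
  carriers take the remainder input in the LINEAR form (AF-1) `|β¹_{k+1}(p)| ≤ Cr·p_k` (field `LimitForm.af1`), which
  for Bałaban's (1.22) is located at the unprinted cubic insertion [II] (P1) (cell record `BETA/AN4.md`).
* `Beta.RemainderChain` (row an4): the printed chain [II] (2.41) + "(1 − 10δ)½L = 1" → [I] (4.2)–(4.5), (4.35), (4.37)
  → (5.10) → (1.22) gives the CONSTANT form `RemainderConst S γ r : ∀ k p ∈ ]0,γ]^{k+1}, |β¹_{k+1}(p)| ≤ r` with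
  `r = ε₁·K_rem`, uniformly in k and in the history, modulo the named printed leaves (`Chain.abs_beta1_le`).

Content (bookkeeping only, [folklore] algebra of inequalities):

1. `eventualForm_of_remainderConst` — the MINIMAL carrier `EventualForm β` from: a one-loop tail bound
   `2b ≤ β⁰_{k+1}` for `k ≥ k₀` (rows an1–an3 / `Beta.LimitRate`), the constant-form remainder bound with `r ≤ b`, the
   printed two-sided bound (TS) and joint continuity (C).  NO linear (AF-1), NO `Cr·γ ≤ b` smallness of the box.
2. `eventualForm_of_limit_remainderConst` — the same from the LIMIT data of `LimitForm` ((AF-0∞) `β⁰_∞ > 0`, (AF-0r)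
   `|β⁰_{k+1} − β⁰_∞| ≤ c₀θ^k`) with the remainder slot weakened to `RemainderConst S γ₀ r`, `r ≤ β⁰_∞/4`: then
   `β_{k+1} ≥ β⁰_∞/2` on the boxes from the first `k₀` with `c₀θ^{k₀} ≤ β⁰_∞/4` on.
3. `eventualForm_of_chain` — the same with the remainder slot filled by a `Beta.RemainderChain.Chain` (the printed
   leaves by name) and the ε₁-restriction `ε₁·K_rem ≤ b` (of the printed type, next to R23 of [II] p. 21).
4. Corollaries by name: `endpointExistence_of_limit_remainderConst`, `thm2_fineLattices_of_chain`,
   `thm2Printed_of_chain_list` — the consumers of `Beta.Assembly`'s minimal carrier are reachable with the remainder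
   input in constant form (the others by dot-notation on `eventualForm_of_chain`); and `LimitForm.remainderConst` —
   the linear form implies the constant form (`r = Cr·γ₀`), so nothing is lost.

Consequence recorded for the cell (BETA-SPEC §6, `BETA/ASSEMBLY.md` (W2), `BETA/REMAINDER-BETA.md` §4): at the
END-STATEMENT grade the remainder row needs no unprinted estimate beyond the located leaves of (5.10) and of [II] §2
(GAPS G-B12s-15, G-adv2-2, G-B13-07…11); the linear form / [II] (P1) is off the critical path.  HONEST FRAMING:
hypothesis carriers and implications only — nothing is asserted about Bałaban's actual (1.22); discharging the
residual inputs would make the UV-stability theorem unconditional (a constructive-QFT result), which is NOT the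
continuum limit and NOT the Clay problem; this file discharges none of them.
-/

namespace Literature.MathematicalPhysics.QuantumFieldTheory.Balaban1983to89.Beta.AssemblyRemainder

open Literature.MathematicalPhysics.QuantumFieldTheory.Balaban1983to89
open Literature.MathematicalPhysics.QuantumFieldTheory.Balaban1983to89.FlowStep
open Literature.MathematicalPhysics.QuantumFieldTheory.Balaban1983to89.DagBinding
open Literature.MathematicalPhysics.QuantumFieldTheory.Balaban1983to89.FlowStepRuns
open Literature.MathematicalPhysics.QuantumFieldTheory.Balaban1983to89.Beta.Assembly
open Literature.MathematicalPhysics.QuantumFieldTheory.Balaban1983to89.Beta.RemainderChain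

noncomputable section

/-! ## 1. The minimal carrier from a one-loop tail bound and the constant-form remainder -/

/-- **`EventualForm` from the split in CONSTANT FORM**: `2b ≤ β⁰_{k+1}` for `k ≥ k₀`, `|β¹_{k+1}| ≤ r ≤ b` on
]0,γ₀]-histories (all k), the printed two-sided bound and joint continuity give the minimal carrier with eventual lower
bound `b` from `k₀` on (`Beta.RemainderChain.betaLowerTail_of_remainderConst`).  No (AF-1), no box smallness.
[cite: Balaban1987RG1, Thm 2 p.259 and §1 p.264] -/
def eventualForm_of_remainderConst {β : HBeta} (S : B12Beta.OneLoopSplit β) {γ₀ b r β' : ℝ} {k₀ : ℕ}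
    (hγ₀ : 0 < γ₀) (hb : 0 < b) (hAF0 : ∀ k, k₀ ≤ k → 2 * b ≤ S.β0 k) (hrem : RemainderConst S γ₀ r)
    (hr : r ≤ b) (hup : BetaUpperH β' γ₀ β) (hlo : ∀ k, ∀ v ∈ Box γ₀ k, -β' ≤ β k v) (hcont : BetaContH γ₀ β) :
    EventualForm β where
  γ₀ := γ₀
  γ₀_pos := hγ₀
  b := b
  b_pos := hb
  k₀ := k₀
  tail := betaLowerTail_of_remainderConst S hAF0 hrem hr
  β' := β'
  upper := hup
  lower := hlo
  cont := hcont

/-- The carrier's constants are the given ones. [folklore] -/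
theorem eventualForm_of_remainderConst_b {β : HBeta} (S : B12Beta.OneLoopSplit β) {γ₀ b r β' : ℝ} {k₀ : ℕ}
    (hγ₀ : 0 < γ₀) (hb : 0 < b) (hAF0 : ∀ k, k₀ ≤ k → 2 * b ≤ S.β0 k) (hrem : RemainderConst S γ₀ r)
    (hr : r ≤ b) (hup : BetaUpperH β' γ₀ β) (hlo : ∀ k, ∀ v ∈ Box γ₀ k, -β' ≤ β k v) (hcont : BetaContH γ₀ β) :
    (eventualForm_of_remainderConst S hγ₀ hb hAF0 hrem hr hup hlo hcont).b = b ∧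
      (eventualForm_of_remainderConst S hγ₀ hb hAF0 hrem hr hup hlo hcont).γ₀ = γ₀ ∧
      (eventualForm_of_remainderConst S hγ₀ hb hAF0 hrem hr hup hlo hcont).k₀ = k₀ :=
  ⟨rfl, rfl, rfl⟩

/-! ## 2. From the limit data (AF-0∞)+(AF-0r) with the remainder in constant form -/

/-- Geometric decay reaches any positive threshold. [folklore] -/
theorem exists_geometric_le {c θ a : ℝ} (hc : 0 ≤ c) (hθ0 : 0 ≤ θ) (hθ1 : θ < 1) (ha : 0 < a) :
    ∃ k₀ : ℕ, ∀ k, k₀ ≤ k → c * θ ^ k ≤ a := by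
  obtain ⟨n, hn⟩ := exists_pow_lt_of_lt_one (div_pos ha (by linarith : (0 : ℝ) < c + 1)) hθ1
  refine ⟨n, fun k hk => ?_⟩
  have hpow : θ ^ k ≤ θ ^ n := pow_le_pow_of_le_one hθ0 hθ1.le hk
  have h1 : c * θ ^ k ≤ c * θ ^ n := mul_le_mul_of_nonneg_left hpow hc
  have h2 : c * θ ^ n ≤ (c + 1) * θ ^ n := by
    have := pow_nonneg hθ0 n
    nlinarith
  have h3 : (c + 1) * θ ^ n ≤ a := by
    have := (lt_div_iff₀ (by linarith : (0 : ℝ) < c + 1)).mp hn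
    linarith
  linarith

/-- The one-loop tail bound from the limit data: `|β⁰_{k+1} − β⁰_∞| ≤ c₀θ^k` and `c₀θ^k ≤ β⁰_∞/4` for `k ≥ k₀` give
`2·(3β⁰_∞/8) ≤ β⁰_{k+1}` there. [folklore] -/
theorem beta0_tail_of_conv {β : HBeta} (S : B12Beta.OneLoopSplit β) {binf c₀ θ : ℝ} {k₀ : ℕ}
    (hconv : ∀ k, |S.β0 k - binf| ≤ c₀ * θ ^ k) (hk₀ : ∀ k, k₀ ≤ k → c₀ * θ ^ k ≤ binf / 4) :
    ∀ k, k₀ ≤ k → 2 * (3 * binf / 8) ≤ S.β0 k := fun k hk => by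
  have h := (abs_le.mp (hconv k)).1
  have h' := hk₀ k hk
  linarith

/-- **`EventualForm` from the LIMIT data with the remainder in constant form**: (AF-0∞) `β⁰_∞ > 0`, (AF-0r)
`|β⁰_{k+1} − β⁰_∞| ≤ c₀θ^k` (`0 ≤ c₀`, `0 ≤ θ < 1`), `RemainderConst S γ₀ r` with `r ≤ β⁰_∞/4`, (TS), (C) give the
minimal carrier with `b = 3β⁰_∞/8 ≥ … ` — precisely: eventual lower bound `3β⁰_∞/8` from the first scale with
`c₀θ^k ≤ β⁰_∞/4` on (so `β_{k+1} ≥ 3β⁰_∞/4 − β⁰_∞/4 = β⁰_∞/2 ≥ 3β⁰_∞/8`).  Compared with `LimitForm.toEventual` the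
(AF-1) slot is replaced by the WEAKER constant form and no `Cr·γ ≤ β⁰_∞` shrinking of the box is needed.
[cite: Balaban1987RG1, Thm 2 p.259 and §1 p.264] -/
theorem eventualForm_of_limit_remainderConst {β : HBeta} (S : B12Beta.OneLoopSplit β) {γ₀ binf c₀ θ r β' : ℝ}
    (hγ₀ : 0 < γ₀) (hbinf : 0 < binf) (hc₀ : 0 ≤ c₀) (hθ0 : 0 ≤ θ) (hθ1 : θ < 1)
    (hconv : ∀ k, |S.β0 k - binf| ≤ c₀ * θ ^ k) (hrem : RemainderConst S γ₀ r) (hr : r ≤ binf / 4)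
    (hup : BetaUpperH β' γ₀ β) (hlo : ∀ k, ∀ v ∈ Box γ₀ k, -β' ≤ β k v) (hcont : BetaContH γ₀ β) :
    ∃ E : EventualForm β, E.γ₀ = γ₀ ∧ E.b = 3 * binf / 8 := by
  obtain ⟨k₀, hk₀⟩ := exists_geometric_le hc₀ hθ0 hθ1 (by linarith : 0 < binf / 4)
  have hAF0 := beta0_tail_of_conv S hconv hk₀
  have hb : 0 < 3 * binf / 8 := by linarith
  have hr' : r ≤ 3 * binf / 8 := hr.trans (by linarith)
  exact ⟨eventualForm_of_remainderConst S hγ₀ hb hAF0 hrem hr' hup hlo hcont, rfl, rfl⟩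

/-- **Endpoint existence from the limit data and the constant-form remainder** (forward-generated constructions):
no (AF-1), no small-k signs, no rate in the conclusion. [cite: Balaban1987RG1, Thm 2 p.259 (first sentence)] -/
theorem endpointExistence_of_limit_remainderConst {C : B12.Construction} {β : HBeta} (hgen : ForwardGenerated C β)
    (S : B12Beta.OneLoopSplit β) {γ₀ binf c₀ θ r β' : ℝ} (hγ₀ : 0 < γ₀) (hbinf : 0 < binf) (hc₀ : 0 ≤ c₀)
    (hθ0 : 0 ≤ θ) (hθ1 : θ < 1) (hconv : ∀ k, |S.β0 k - binf| ≤ c₀ * θ ^ k) (hrem : RemainderConst S γ₀ r)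
    (hr : r ≤ binf / 4) (hup : BetaUpperH β' γ₀ β) (hlo : ∀ k, ∀ v ∈ Box γ₀ k, -β' ≤ β k v)
    (hcont : BetaContH γ₀ β) : EndpointExistence C := by
  obtain ⟨E, -, -⟩ := eventualForm_of_limit_remainderConst S hγ₀ hbinf hc₀ hθ0 hθ1 hconv hrem hr hup hlo hcont
  exact E.endpointExistence hgen

/-! ## 3. The remainder slot filled by the printed chain -/

/-- **`EventualForm` from a one-loop tail bound and a REMAINDER CHAIN** (the printed leaves by name, row an4) under the
ε₁-restriction `ε₁·K_rem ≤ b`. [cite: Balaban1988RG2Cluster, (2.41) p.21; Balaban1987RG1, (5.10) p.293] -/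
def eventualForm_of_chain {d : ℕ} {μ ν : Fin d} {β : HBeta} (S : B12Beta.OneLoopSplit β) {γ₀ b β' : ℝ}
    {c : B13.Consts} {α₂ B₃ c₁ K₀ K₁ : ℝ} {k₀ : ℕ} (R : Chain d μ ν S γ₀ c α₂ B₃ c₁ K₀ K₁)
    (hs : ChainSigns c α₂ B₃ K₀) (hγ₀ : 0 < γ₀) (hb : 0 < b) (hAF0 : ∀ k, k₀ ≤ k → 2 * b ≤ S.β0 k)
    (hε₁ : c.ε₁ * remCoeff d c α₂ B₃ c₁ K₀ K₁ ≤ b) (hup : BetaUpperH β' γ₀ β)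
    (hlo : ∀ k, ∀ v ∈ Box γ₀ k, -β' ≤ β k v) (hcont : BetaContH γ₀ β) : EventualForm β :=
  eventualForm_of_remainderConst S hγ₀ hb hAF0 (R.abs_beta1_le hs) hε₁ hup hlo hcont

/-- **The lower half of (0.31) on FINE lattices from a one-loop tail bound and the printed remainder chain** — no small-k
sign (`EventualForm.thm2_fineLattices` of row an5). [cite: Balaban1987RG1, Thm 2 (0.31) p.259] -/
theorem thm2_fineLattices_of_chain {d : ℕ} {μ ν : Fin d} {β : HBeta} (S : B12Beta.OneLoopSplit β) {γ₀ b β' : ℝ}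
    {c : B13.Consts} {α₂ B₃ c₁ K₀ K₁ : ℝ} {k₀ : ℕ} (R : Chain d μ ν S γ₀ c α₂ B₃ c₁ K₀ K₁)
    (hs : ChainSigns c α₂ B₃ K₀) (hγ₀ : 0 < γ₀) (hb : 0 < b) (hAF0 : ∀ k, k₀ ≤ k → 2 * b ≤ S.β0 k)
    (hε₁ : c.ε₁ * remCoeff d c α₂ B₃ c₁ K₀ K₁ ≤ b) (hup : BetaUpperH β' γ₀ β)
    (hlo : ∀ k, ∀ v ∈ Box γ₀ k, -β' ≤ β k v) (hcont : BetaContH γ₀ β)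
    {C : B12.Construction} (hgen : ForwardGenerated C β) :
    ∀ (m : ℕ) (γ : ℝ), 0 < γ → γ ≤ γ₀ → ∀ g : ℝ, 0 < g → 1 / γ ^ 2 + β' * k₀ ≤ 1 / g ^ 2 →
      ∀ K : ℕ, (3 * b + 2 * β') * k₀ ≤ b * K →
        ∃ g0 : ℝ, (C ⟨K, m, g0⟩).flow.InInterval γ K ∧ (C ⟨K, m, g0⟩).flow.g K = g ∧
          Step.Discrete031 (b / 2) β' K g (C ⟨K, m, g0⟩).flow.g :=
  (eventualForm_of_chain S R hs hγ₀ hb hAF0 hε₁ hup hlo hcont).thm2_fineLattices hgen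

/-- **Theorem 2 AS PRINTED from a one-loop tail bound, the printed remainder chain and the finite β-level list**
(`EventualForm.thm2Printed_of_list` of row an5; the list is where the small-k signs are consumed).
[cite: Balaban1987RG1, Thm 2 p.259 with (0.31)] -/
theorem thm2Printed_of_chain_list {d : ℕ} {μ ν : Fin d} {β : HBeta} (S : B12Beta.OneLoopSplit β) {γ₀ b β' : ℝ}
    {c : B13.Consts} {α₂ B₃ c₁ K₀ K₁ : ℝ} {k₀ : ℕ} (R : Chain d μ ν S γ₀ c α₂ B₃ c₁ K₀ K₁)
    (hs : ChainSigns c α₂ B₃ K₀) (hγ₀ : 0 < γ₀) (hb : 0 < b) (hAF0 : ∀ k, k₀ ≤ k → 2 * b ≤ S.β0 k)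
    (hε₁ : c.ε₁ * remCoeff d c α₂ B₃ c₁ K₀ K₁ ≤ b) (hup : BetaUpperH β' γ₀ β)
    (hlo : ∀ k, ∀ v ∈ Box γ₀ k, -β' ≤ β k v) (hcont : BetaContH γ₀ β)
    {C : B12.Construction} (hgen : ForwardGenerated C β) {L : ℝ} (hL : 1 < L)
    (hsmall : ∀ k, k < k₀ → ∀ v ∈ Box γ₀ k, b ≤ β k v) : B12.Thm2Printed C L :=
  (eventualForm_of_chain S R hs hγ₀ hb hAF0 hε₁ hup hlo hcont).thm2Printed_of_list hgen hL hsmall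

/-! ## 4. Nothing is lost: the linear form gives the constant form -/

/-- A `LimitForm`'s (AF-1) field gives the constant form with `r = Cr·γ₀`
(`Beta.RemainderChain.remainderConst_of_af1`). [folklore] -/
theorem LimitForm.remainderConst {β : HBeta} (D : LimitForm β) : RemainderConst D.S D.γ₀ (D.Cr * D.γ₀) :=
  remainderConst_of_af1 D.S D.Cr_nonneg D.af1

/-- … and on any smaller box `]0,γ]`, with `r = Cr·γ`. [folklore] -/
theorem LimitForm.remainderConst_mono {β : HBeta} (D : LimitForm β) {γ : ℝ} (hγ : γ ≤ D.γ₀) :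
    RemainderConst D.S γ (D.Cr * γ) :=
  remainderConst_of_af1 D.S D.Cr_nonneg (D.af1_mono hγ)

end

end Literature.MathematicalPhysics.QuantumFieldTheory.Balaban1983to89.Beta.AssemblyRemainder
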